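import Mathlib
import HarnessLib
/-!
# Corner coefficient, corner law and corner characteristic speed of the self-similar profile system in
# Elgindi's `(z, θ)` gauge — the real algebra behind both Z6 engines' «m_char» print

HONEST FRAMING (cell ns-blowup GROUP B «PROFILE SEARCH», zone Z6 «Elgindi-type C^{1,α} no-swirl self-similar blow-up»;
human rulings D-0035/D-0074/D-0081): pen-and-paper **real algebra** about the ν = 0 axisymmetric NO-SWIRL **EULER** profile
system (tree `Literature.Analysis.FluidPDE.Elgindi.IsProfile`) written in the class `F = Γ(θ) e^{qs} H(s, θ)`, `s = ln z`
(Z6 SHEET v1 §1.A (S-class); engine-B custody note ENGINE-B.md v0.3 §D1′). Not Navier–Stokes; «violates: none — MODEL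
(Euler)». Nothing here asserts that a profile exists; the objects are the COEFFICIENTS of the transport form
`a H_s + U H_θ = c H` evaluated at the corner `z → 0`, where `Φ(0, θ) = A sin 2θ` gives
`U₀ = −3A sin 2θ`, `V₀ = 2A(1 − 3 sin²θ)`, `ℛ₀ = 2A`, and for `Γ = sinᵃθ cosᵇθ`, `U₀Γ′/Γ = −6A(a cos²θ − b sin²θ)`.
WHAT IS KERNEL-CHECKED (with `x := sin²θ`):
* `corner_coeff_theta_terms`: the θ-dependent part `−2qαA(1−3x) + 6A(a(1−x) − bx)` of the corner coefficient
  `c₀ = ℛ₀ − 1 − q(1+δ) − qαV₀ − U₀Γ′/Γ` is the CONSTANT `A(4a − 2b)` as soon as `qα = a + b` (the class is homogeneous: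
  `ρ^{qα} sinᵃθ cosᵇθ = x₃ᵃ rᵇ`) — so the corner law is ONE scalar condition, for both classes used by the engines;
* `corner_coeff_E` / `cornerLaw_E_iff`: Elgindi class (`q = 1`, `a = α/3`, `b = 2α/3`): `c₀ = 2A − 2 − δ`, corner law
  `A = 1 + δ/2`, i.e. `L₁₂(F)(0) = 2α(2+δ)` (SHEET §1.A «DERIVED CORNER LAW», = Elgindi's `λ = −2μ/(1+μ)` in the μ = 0 gauge);
* `corner_coeff_HZ` / `cornerLaw_HZ_iff`: Hou–Zhang class (`q = (1+α)/α`, `a = 1`, `b = α`):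
  `c₀ = (6−2α)A − 1 − (1+α)(1+δ)/α`;
* `cornerSpeed_E`, `cornerSpeed_E_pos_iff`: the s-characteristic speed at the axis corner `(1+δ) + αV₀(π/2) = (1+δ) − 4αA`
  equals `(1+δ) − 2α(2+δ)` under the Elgindi corner law and is positive iff `α < (1+δ)/(2(2+δ))` (SHEET §6.1 `α_f(δ)`,
  refuter finding F-Z6-c «characteristic reversal»);
* `cornerSpeed_HZ`, `cornerSpeed_HZ_pos_iff`: in the Hou–Zhang class with `1+δ = α c_l` the same speed is
  `α(c_l(2−6α) − 4)/(6−2α)`, positive iff `c_l > 2/(1−3α)` for `0 < α < 1/3` — exactly the inequality every collapsing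
  profile of the 1-D axis MODEL satisfies (`AxisModelExponentDictionary.houZhang_lt_cx`), so the corner stays a pure inflow
  node wherever that inequality holds.
WHAT IS NOT PROVED: anything about solutions of the profile system (existence, the values of `A`, `δ`, `c_l`); the
identification of `U₀, V₀, ℛ₀` with the corner limits of `opU, opV, opR` is the engines' pen derivation (SHEET §1.A), not
restated as a theorem here. PLACEMENT: cell-own MODEL/Euler-gauge lemma next to `AxisModelExponentDictionary`
(profile-eng-10); bears on LADDER-NS N5 / zone Z6 → N1 linear core (engine custody: both engines print `m_char`).
-/

namespace Summit.NavierStokesRegularity.OSWSelfSimilar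
namespace ElgindiGaugeCornerSpeed

/-- **θ-independence of the corner coefficient.** For a corner weight `Γ = sinᵃθ cosᵇθ` with ray order `q` and
`qα = a + b`, the θ-dependent terms `−qαV₀ − U₀Γ′/Γ = −2qαA(1 − 3x) + 6A(a(1 − x) − bx)` (`x = sin²θ`) collapse to the
constant `A(4a − 2b)`. [new here — MODEL/Euler gauge algebra; ENGINE-B.md v0.3 §D1′] -/
theorem corner_coeff_theta_terms (A q α a b x : ℝ) (h : q * α = a + b) :
    -(2 * q * α * A * (1 - 3 * x)) + 6 * A * (a * (1 - x) - b * x) = A * (4 * a - 2 * b) := by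
  linear_combination (A * (6 * x - 2)) * h

/-- **Corner coefficient, Elgindi class** (`q = 1`, `a = α/3`, `b = 2α/3`): `c₀ = ℛ₀ − 1 − q(1+δ) − qαV₀ − U₀Γ′/Γ`
with `ℛ₀ = 2A`, `V₀ = 2A(1−3x)`, `−U₀Γ′/Γ = 6A(a(1−x) − bx)` equals `2A − 2 − δ`, independently of `x = sin²θ`.
[new here — MODEL/Euler gauge algebra; Z6 SHEET v1 §1.A] -/
theorem corner_coeff_E (A δ α x : ℝ) :
    (2 * A - 1 - 1 * (1 + δ)) - 1 * α * (2 * A * (1 - 3 * x)) + 6 * A * (α / 3 * (1 - x) - 2 * α / 3 * x)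
      = 2 * A - 2 - δ := by
  ring

/-- **Corner law, Elgindi class**: `c₀ = 0` iff `A = 1 + δ/2` (i.e. `L₁₂(F)(0) = 4αA = 2α(2+δ)`; Elgindi's
`λ = −2μ/(1+μ)` written in the `μ = 0` gauge). [new here — MODEL/Euler gauge algebra; Z6 SHEET v1 §1.A] -/
theorem cornerLaw_E_iff (A δ : ℝ) : 2 * A - 2 - δ = 0 ↔ A = 1 + δ / 2 := by
  constructor <;> intro h <;> linarith

/-- **Corner coefficient, Hou–Zhang class** (`q = (1+α)/α`, `a = 1`, `b = α`, `α ≠ 0`):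
`c₀ = (6 − 2α)A − 1 − (1+α)(1+δ)/α`, independently of `x = sin²θ`. [new here — MODEL/Euler gauge algebra; ENGINE-B.md v0.3 §D1′] -/
theorem corner_coeff_HZ (A δ α x : ℝ) (hα : α ≠ 0) :
    (2 * A - 1 - (1 + α) / α * (1 + δ)) - (1 + α) / α * α * (2 * A * (1 - 3 * x)) + 6 * A * (1 * (1 - x) - α * x)
      = (6 - 2 * α) * A - 1 - (1 + α) * (1 + δ) / α := by
  field_simp
  ring

/-- **Corner law, Hou–Zhang class**: `c₀ = 0` iff `A = (1 + (1+α)(1+δ)/α)/(6 − 2α)` (`6 − 2α ≠ 0`).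
[new here — MODEL/Euler gauge algebra; ENGINE-B.md v0.3 §D1′] -/
theorem cornerLaw_HZ_iff (A δ α : ℝ) (h6 : 6 - 2 * α ≠ 0) :
    (6 - 2 * α) * A - 1 - (1 + α) * (1 + δ) / α = 0 ↔ A = (1 + (1 + α) * (1 + δ) / α) / (6 - 2 * α) := by
  rw [eq_div_iff h6]
  constructor <;> intro h <;> linarith

/-- **Corner characteristic speed, Elgindi class**: at the axis corner `V₀(π/2) = −4A`, so the s-speed
`(1+δ) + αV₀ = (1+δ) − 4αA`; under the corner law `A = 1 + δ/2` this is `(1+δ) − 2α(2+δ)`.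
[new here — MODEL/Euler gauge algebra; Z6 SHEET v1 §6.1] -/
theorem cornerSpeed_E (δ α : ℝ) : (1 + δ) - 4 * α * (1 + δ / 2) = (1 + δ) - 2 * α * (2 + δ) := by
  ring

/-- **Characteristic-reversal threshold, Elgindi class** (SHEET §6.1 `α_f(δ) = (1+δ)/(2(2+δ))`): for `2 + δ > 0` the corner
speed `(1+δ) − 2α(2+δ)` is positive iff `α < (1+δ)/(2(2+δ))`. [new here — MODEL/Euler gauge algebra; Z6 SHEET v1 §6.1] -/
theorem cornerSpeed_E_pos_iff (δ α : ℝ) (h : 0 < 2 + δ) :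
    0 < (1 + δ) - 2 * α * (2 + δ) ↔ α < (1 + δ) / (2 * (2 + δ)) := by
  rw [lt_div_iff₀ (by positivity)]
  constructor <;> intro h' <;> nlinarith [h, h']

/-- **Corner characteristic speed, Hou–Zhang class**: with `1 + δ = α c_l` (SHEET §1.5) and the HZ corner law
`A = (1 + (1+α)c_l)/(6 − 2α)`, the speed `(1+δ) − 4αA = α(c_l(2 − 6α) − 4)/(6 − 2α)` (`6 − 2α ≠ 0`).
[new here — MODEL/Euler gauge algebra; ENGINE-B.md v0.3 §D1′] -/
theorem cornerSpeed_HZ (α cl : ℝ) (h6 : 6 - 2 * α ≠ 0) :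
    α * cl - 4 * α * ((1 + (1 + α) * cl) / (6 - 2 * α)) = α * (cl * (2 - 6 * α) - 4) / (6 - 2 * α) := by
  rw [eq_div_iff h6, sub_mul, mul_assoc (4 * α), div_mul_cancel₀ _ h6]
  ring

/-- **HZ-class corner inflow criterion**: for `0 < α < 1/3` the corner speed `α(c_l(2 − 6α) − 4)/(6 − 2α)` is positive iff
`c_l > 2/(1 − 3α)` — the strict inequality satisfied by every collapsing profile of the 1-D axis MODEL
(`AxisModelExponentDictionary.houZhang_lt_cx`), so wherever it holds the corner `z = 0` remains a pure inflow node of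
the transport form. [new here — MODEL/Euler gauge algebra; ENGINE-B.md v0.3 §D1′] -/
theorem cornerSpeed_HZ_pos_iff (α cl : ℝ) (hα0 : 0 < α) (hα : α < 1 / 3) :
    0 < α * (cl * (2 - 6 * α) - 4) / (6 - 2 * α) ↔ 2 / (1 - 3 * α) < cl := by
  have h1 : 0 < 1 - 3 * α := by linarith
  have h2 : 0 < 6 - 2 * α := by linarith
  rw [div_lt_iff₀ h1]
  have key : α * (cl * (2 - 6 * α) - 4) / (6 - 2 * α) = (α / (6 - 2 * α)) * (2 * (cl * (1 - 3 * α) - 2)) := by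
    field_simp
    ring
  rw [key, mul_pos_iff_of_pos_left (div_pos hα0 h2)]
  constructor <;> intro h' <;> nlinarith [h']

end ElgindiGaugeCornerSpeed
end Summit.NavierStokesRegularity.OSWSelfSimilar

/-! ## Appendix (ns-blowup-profile-eng-10 g4, 2026-08-27): homogeneity instances and the plane-side corner layer

HONEST FRAMING as above: MODEL/Euler-gauge **real algebra** plus one-variable real calculus of `θ ↦ θ^β`; nothing about
solutions of the profile system is asserted. WHAT IS KERNEL-CHECKED HERE:
* `classE_homogeneity` / `classHZ_homogeneity`: the hypothesis `qα = a + b` of `corner_coeff_theta_terms` holds for the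
  two classes the engines use (E: `q = 1`, `(a, b) = (α/3, 2α/3)`; HZ: `q = (1+α)/α`, `(a, b) = (1, α)`), and
  `classE_weight_split`: `(sin θ cos²θ)^{α/3} = sin^{α/3}θ · cos^{2α/3}θ` on the closed quarter `sin θ, cos θ ≥ 0`
  (so the class-E AXIS order is `b = 2α/3`; the engines' «axis-layer exponent 1 + 2α/3» print names `1 + b`);
* `planeSpeed_E`: at the corner the s-characteristic speed ON THE PLANE `x = sin²θ = 0` is
  `a₀(0) = (1+δ) + αV₀(0) = (1+δ) + 2αA` (`V₀ = 2A(1 − 3x)`), and under the Elgindi corner law `A = 1 + δ/2` it is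
  `1 + δ + α(2+δ)`;
* `planeModelODE_rpow` / `planeModelODE_exponent_iff`: for `A ≠ 0` the power `θ^γ` solves the linearised plane-corner
  transport model `6Aθ·y′ = a₀·y` on `θ > 0` iff `γ = a₀/(6A)` (`U₀ = −3A sin 2θ = −6Aθ(1 + O(θ²))` is the engines' pen
  linearisation, ENGINE-B.md v0.3 §D2′; the model ODE, not the profile equation, is what is typed);
* `planeLayerExponent_E`: with `a₀ = (1+δ) + 2αA` and `A = 1 + δ/2`, `a₀/(6A) = (1+δ+α(2+δ))/(3(2+δ))` — the
  «plane-layer exponent β» both Z6 engines print for the Elgindi-branch MODEL profile (engine B v0.6 fitted 0.19 vs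
  0.195 at α_E = 0.05 and 0.28 vs 0.287 at α_E = 0.20; HOME/profile/z6twin/README.md «Structural prints»).
WHAT IS NOT PROVED: that the profile's order-`z` corrector actually follows the model ODE near the plane (pen, §D2′),
or any statement about existence/regularity of profiles. bears_on: LADDER-NS N5/Z6 engine custody → N1 linear core.
-/

namespace Summit.NavierStokesRegularity.OSWSelfSimilar
namespace ElgindiGaugeCornerSpeed

/-- **Class E is homogeneous**: `qα = a + b` with `q = 1`, `a = α/3`, `b = 2α/3` (the hypothesis of
`corner_coeff_theta_terms`). [new here — MODEL/Euler gauge algebra; Z6 SHEET v1 §1.A] -/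
theorem classE_homogeneity (α : ℝ) : 1 * α = α / 3 + 2 * α / 3 := by
  ring

/-- **Class HZ is homogeneous**: `qα = a + b` with `q = (1+α)/α`, `a = 1`, `b = α` (`α ≠ 0`).
[new here — MODEL/Euler gauge algebra; ENGINE-B.md v0.3 §D1′] -/
theorem classHZ_homogeneity (α : ℝ) (hα : α ≠ 0) : (1 + α) / α * α = 1 + α := by
  field_simp

/-- **Class-E weight split**: on the closed quarter `sin θ ≥ 0`, `cos θ ≥ 0` the Elgindi corner weight
`Γ_E = (sin θ cos²θ)^{α/3}` factors as `sin^{α/3}θ · cos^{2α/3}θ` — plane order `a = α/3`, axis order `b = 2α/3`.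
[new here — MODEL/Euler gauge algebra; Elgindi arXiv:1904.04795 §9 `Γ = (sin θ cos²θ)^{α/3}`] -/
theorem classE_weight_split (α θ : ℝ) (hs : 0 ≤ Real.sin θ) (hc : 0 ≤ Real.cos θ) :
    (Real.sin θ * Real.cos θ ^ 2) ^ (α / 3) = Real.sin θ ^ (α / 3) * Real.cos θ ^ (2 * α / 3) := by
  rw [Real.mul_rpow hs (sq_nonneg _)]
  congr 1
  rw [show (2 : ℝ) * α / 3 = 2 * (α / 3) by ring, Real.rpow_mul hc, Real.rpow_two]

/-- **Plane-side corner speed, Elgindi class**: on the plane `x = sin²θ = 0` the corner s-speed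
`(1+δ) + αV₀(0)` with `V₀ = 2A(1−3x)` equals `(1+δ) + 2αA`, and under the corner law `A = 1 + δ/2` it equals
`1 + δ + α(2+δ)`. [new here — MODEL/Euler gauge algebra; ENGINE-B.md v0.3 §D2′] -/
theorem planeSpeed_E (δ α : ℝ) :
    (1 + δ) + α * (2 * (1 + δ / 2) * (1 - 3 * 0)) = 1 + δ + α * (2 + δ) := by
  ring

/-- **The power law solves the linearised plane-corner transport model**: for `A ≠ 0` and `θ > 0`,
`y(θ) = θ^{a₀/(6A)}` satisfies `6Aθ·y′(θ) = a₀·y(θ)`. [new here — one-variable real calculus for the MODEL ODE of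
ENGINE-B.md v0.3 §D2′] -/
theorem planeModelODE_rpow (A a₀ : ℝ) (hA : A ≠ 0) {θ : ℝ} (hθ : 0 < θ) :
    6 * A * θ * deriv (fun t : ℝ => t ^ (a₀ / (6 * A))) θ = a₀ * θ ^ (a₀ / (6 * A)) := by
  rw [Real.deriv_rpow_const]
  have h6 : (6 : ℝ) * A ≠ 0 := mul_ne_zero (by norm_num) hA
  have key : θ * θ ^ (a₀ / (6 * A) - 1) = θ ^ (a₀ / (6 * A)) := by
    rw [mul_comm, ← Real.rpow_add_one hθ.ne', sub_add_cancel]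
  calc 6 * A * θ * (a₀ / (6 * A) * θ ^ (a₀ / (6 * A) - 1))
      = a₀ * ((6 * A) / (6 * A)) * (θ * θ ^ (a₀ / (6 * A) - 1)) := by ring
    _ = a₀ * θ ^ (a₀ / (6 * A)) := by rw [div_self h6, mul_one, key]

/-- **Exponent selection**: for `A ≠ 0`, the power `θ^γ` solves the model `6Aθ·y′ = a₀·y` on all of `θ > 0` iff
`γ = a₀/(6A)` (evaluate at `θ = 1`). [new here — one-variable real calculus for the MODEL ODE of ENGINE-B.md v0.3 §D2′] -/
theorem planeModelODE_exponent_iff (A a₀ γ : ℝ) (hA : A ≠ 0) :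
    (∀ θ : ℝ, 0 < θ → 6 * A * θ * deriv (fun t : ℝ => t ^ γ) θ = a₀ * θ ^ γ) ↔ γ = a₀ / (6 * A) := by
  have h6 : (6 : ℝ) * A ≠ 0 := mul_ne_zero (by norm_num) hA
  constructor
  · intro h
    have h1 := h 1 one_pos
    rw [Real.deriv_rpow_const, Real.one_rpow, Real.one_rpow] at h1
    rw [eq_div_iff h6]
    linarith
  · rintro rfl θ hθ
    exact planeModelODE_rpow A a₀ hA hθ

/-- **Plane-layer exponent, Elgindi class**: with the plane speed `a₀ = (1+δ) + 2αA` and the corner law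
`A = 1 + δ/2`, `β = a₀/(6A) = (1 + δ + α(2+δ))/(3(2+δ))` — the exponent both Z6 engines print (meaningful for
`2 + δ ≠ 0`; as an identity of real division, where `x/0 = 0`, it needs no hypothesis).
[new here — MODEL/Euler gauge algebra; HOME/profile/z6twin/README.md «Structural prints»] -/
theorem planeLayerExponent_E (δ α : ℝ) :
    ((1 + δ) + 2 * α * (1 + δ / 2)) / (6 * (1 + δ / 2)) = (1 + δ + α * (2 + δ)) / (3 * (2 + δ)) := by
  have h3 : (6 : ℝ) * (1 + δ / 2) = 3 * (2 + δ) := by ring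
  rw [h3]
  congr 1
  ring

end ElgindiGaugeCornerSpeed
end Summit.NavierStokesRegularity.OSWSelfSimilar
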